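import Literature.Computability.Complexity.FKPointLocationSizes
import HarnessLib

/-!
# Fournier–Koiran point location, XIV: the NP certificates of the location procedure

Topic `Literature/Computability/Complexity`, grouping namespace `FKPointLocation`. The Boolean
statements asked by the location procedure ("is there a valid triple for the next chain slot?",
"is this a prefix of the code of one?", "is the scale unstable?", "is this a prefix of the code of
an apex?", report §2.1, asked "with a boolean NP algorithm") are here given EXPLICIT polynomial-size
certificates and Boolean verifiers on the untyped data (`uExCheck`, `uPfCheck`, `uStCheck`,
`uApCheck`: integer arithmetic on decoded fixed-width codes), and each is proved equivalent to
the typed statement `npTruth` of `FKPointLocationProtocol.lean` (`npTruth_ex_iff`, `…_pf_iff`,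
`…_st_iff`, `…_ap_iff`): soundness by reading the decoded integers as rational points, completeness
by the small witnesses of `FKPointLocationLevel.lean` (whose `2^W` bounds are exactly the widths of
the codes).

## References

* H. Fournier, P. Koiran, *Lower bounds are not easier over the reals: inside PH*, ICALP 2000,
  LNCS 1853 = LIP RR-1999-21, §2.1 (the four NP conditions), §2.2 (their polynomial size).
  [FournierKoiran2000]
-/

namespace Literature.Computability.Complexity

namespace FKPointLocation

open Classical Finset

/-! ### Untyped verifiers -/

section Untyped

/-- Integer liveness: `|a_i| ≤ B` and `a ⊥` all earlier apex numerators. [cite: FournierKoiran2000, §2.1] -/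
def uLiveI (B : ℕ) (prev : List (List ℤ)) (a : List ℤ) : Bool :=
  a.all (fun x => decide (x.natAbs ≤ B)) && prev.all (fun σ => decide (udot a σ = 0))

/-- The free `ℓ¹`-mass `∑_{χ_i = 0} |a_i|`. [folklore] -/
def ufreeMass (χ a : List ℤ) : ℕ := (List.zipWith (fun c x => if c = 0 then x.natAbs else 0) χ a).sum

/-- Integer meeting test at scale `sc`. [cite: FournierKoiran2000, §2.1] -/
def uMeetsI (κ sc : ℕ) (χ m a : List ℤ) : Bool := decide ((udot a m).natAbs ≤ 2 ^ (κ * sc) * ufreeMass χ a)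

/-- Integer membership of `N/dd` in the space `E ch` of the chart `χ` (with `dd > 0`). [cite: FournierKoiran2000, §2.1] -/
def uInE (χ : List ℤ) (ch : List (List ℤ)) (N : List ℤ) (dd : ℕ) : Bool :=
  decide (0 < dd) && (List.zipWith (fun c x => decide (c = 0 ∨ x = c * (dd : ℤ))) χ N).all id &&
    ch.all (fun a => decide (udot a N = 0))

/-- The core of the triple test, on a decoded form `a` and two decoded points. [cite: FournierKoiran2000, §2.1] -/
def uTripleCore (P : UParams) (B : ℕ) (d : UData) (sc : ℕ) (a : List ℤ) (z z' : List ℤ × ℕ) : Bool :=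
  uLiveI B (d.levels.map ULevelRec.apexN) a && uMeetsI P.κ sc d.chart d.cur.m a &&
    uInE d.chart d.cur.chain z.1 z.2 && !decide (udot a z.1 = 0) &&
    uInE d.chart d.cur.chain z'.1 z'.2 && decide (udot a z'.1 = 0)

/-- The two points of a certificate after the form code. [folklore] -/
def uPts (P : UParams) (cert : List Bool) : (List ℤ × ℕ) × (List ℤ × ℕ) :=
  (udecodeApex P.W P.D ((cert.drop P.Wf).take P.Wa), udecodeApex P.W P.D ((cert.drop (P.Wf + P.Wa)).take P.Wa))

/-- **Verifier of the existence query** `ex sc m`: certificate = form code, point off, point on.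
[cite: FournierKoiran2000, §2.1 ("there exists `h ∈ H_n^1` such that …", decided with an NP oracle)] -/
def uExCheck (P : UParams) (B : ℕ) (d : UData) (sc : ℕ) (cert : List Bool) : Bool :=
  uTripleCore P B d sc (udecodeForm P.bB P.D (cert.take P.Wf)) (uPts P cert).1 (uPts P cert).2

/-- **Verifier of the prefix query** `pf sc m w`: the form code extends the recorded bits and `1`.
[cite: FournierKoiran2000, §2.1 (prefix search)] -/
def uPfCheck (P : UParams) (B : ℕ) (d : UData) (sc : ℕ) (cert : List Bool) : Bool :=
  decide (P.Wf ≤ cert.length) && decide ((cert.take P.Wf).take (d.cur.bits.length + 1) = d.cur.bits ++ [true]) &&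
    uExCheck P B d sc cert

/-- **Verifier of the stability query** `st sc`: a form of `F (sc+1)` off some point of `E ch`.
[cite: FournierKoiran2000, §2.1] -/
def uStCheck (P : UParams) (B : ℕ) (d : UData) (sc : ℕ) (cert : List Bool) : Bool :=
  let a := udecodeForm P.bB P.D (cert.take P.Wf)
  let z := (uPts P cert).1
  uLiveI B (d.levels.map ULevelRec.apexN) a && uMeetsI P.κ (sc + 1) d.chart d.cur.m a &&
    uInE d.chart d.cur.chain z.1 z.2 && !decide (udot a z.1 = 0)

/-- The nearness test of an apex: `4 |N_i 2^{L+1} - m_i dd| ≤ dd 2^{κ (sc+1)}` on free coordinates.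
[cite: FournierKoiran2000, §2.1 ("a point `s_n^1` such that `‖s_n^1 - x‖ ≤ r_n/2`")] -/
def uNear (L e : ℕ) (χ m N : List ℤ) (dd : ℕ) : Bool :=
  (List.zipWith (fun c (p : ℤ × ℤ) => decide (c = 0 → 4 * (p.2 * 2 ^ (L + 1) - p.1 * (dd : ℤ)).natAbs ≤ dd * 2 ^ e))
    χ (List.zip m N)).all id

/-- **Verifier of the apex query** `ap w`: the apex code extends the recorded bits and `1` (the
stable scale is clamped to the budget `U`, harmless on genuine runs). [cite: FournierKoiran2000, §2.1] -/
def uApCheck (P : UParams) (U : ℕ) (d : UData) (cert : List Bool) : Bool :=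
  let sc := min ((d.cur.stable.map Prod.fst).getD 0) U
  let ch := (d.cur.stable.map Prod.snd).getD []
  let z := udecodeApex P.W P.D (cert.take P.Wa)
  decide (P.Wa ≤ cert.length) && decide ((cert.take P.Wa).take (d.cur.bits.length + 1) = d.cur.bits ++ [true]) &&
    uInE d.chart ch z.1 z.2 && uNear P.L (P.κ * (sc + 1)) d.chart d.cur.m z.1 z.2

end Untyped

/-! ### Bridges from the typed data -/

section Bridges

variable {Q : LevelParams} {D : ℕ}

/-- `all` over `ofFn`. [folklore] -/
theorem all_ofFn {α : Type} (f : Fin D → α) (p : α → Bool) : (List.ofFn f).all p = decide (∀ i, p (f i) = true) := by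
  rw [Bool.eq_iff_iff, List.all_eq_true, decide_eq_true_iff]
  simp [List.mem_ofFn]

/-- `uLiveI` is `LiveI`. [folklore] -/
theorem uLiveI_iff (B : ℕ) (prev : List (Fin D → ℤ)) (a : Fin D → ℤ) :
    uLiveI B (prev.map List.ofFn) (List.ofFn a) = true ↔ (∀ i, (a i).natAbs ≤ B) ∧ ∀ σ ∈ prev, ∑ i, a i * σ i = 0 := by
  simp only [uLiveI, Bool.and_eq_true, List.all_eq_true, List.mem_map, decide_eq_true_eq, List.forall_mem_ofFn_iff,
    forall_exists_index, and_imp]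
  constructor
  · rintro ⟨h1, h2⟩
    exact ⟨h1, fun σ hσ => by have := h2 _ σ hσ rfl; rwa [udot_ofFn] at this⟩
  · rintro ⟨h1, h2⟩
    refine ⟨h1, ?_⟩
    rintro _ σ hσ rfl
    rw [udot_ofFn]; exact h2 σ hσ

/-- The free mass is the filtered sum. [folklore] -/
theorem ufreeMass_ofFn (χ a : Fin D → ℤ) :
    ufreeMass (List.ofFn χ) (List.ofFn a) = ∑ i ∈ univ.filter (fun i => χ i = 0), (a i).natAbs := by
  rw [ufreeMass, zipWith_ofFn, List.sum_ofFn, Finset.sum_filter]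

/-- `uMeetsI` is `MeetsI`. [folklore] -/
theorem uMeetsI_iff (Λ : LevelCtx Q) (sc : ℕ) (a : Fin Q.D → ℤ) :
    uMeetsI Q.κ sc (List.ofFn Λ.χ) (List.ofFn Λ.m) (List.ofFn a) = true ↔ Λ.MeetsI sc a := by
  rw [uMeetsI, decide_eq_true_iff, udot_ofFn, ufreeMass_ofFn, LevelCtx.MeetsI]

/-- `uInE` in typed terms. [folklore] -/
theorem uInE_iff (χ : Fin D → ℤ) (ch : List (Fin D → ℤ)) (N : Fin D → ℤ) (dd : ℕ) :
    uInE (List.ofFn χ) (ch.map List.ofFn) (List.ofFn N) dd = true ↔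
      0 < dd ∧ (∀ i, χ i ≠ 0 → N i = χ i * dd) ∧ ∀ a ∈ ch, ∑ k, a k * N k = 0 := by
  simp only [uInE, Bool.and_eq_true, decide_eq_true_eq, zipWith_ofFn, all_ofFn, id, List.all_eq_true, List.mem_map,
    forall_exists_index, and_imp]
  constructor
  · rintro ⟨⟨h0, h1⟩, h2⟩
    refine ⟨h0, fun i hi => ?_, fun a ha => ?_⟩
    · have := h1 i; rcases this with h | h
      · exact absurd h hi
      · exact h
    · have := h2 _ a ha rfl; rwa [udot_ofFn] at this
  · rintro ⟨h0, h1, h2⟩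
    refine ⟨⟨h0, fun i => ?_⟩, ?_⟩
    · by_cases h : χ i = 0
      · exact Or.inl h
      · exact Or.inr (h1 i h)
    · rintro _ a ha rfl; rw [udot_ofFn]; exact h2 a ha

/-- A rational point `N/dd` (`dd > 0`) lies in `E ch` iff the integer conditions hold. [folklore] -/
theorem mem_E_div_iff (Λ : LevelCtx Q) (ch : List (Fin Q.D → ℤ)) (N : Fin Q.D → ℤ) {dd : ℕ} (hdd : 0 < dd) :
    (fun k => (N k : ℝ) / dd) ∈ Λ.E ch ↔ (∀ i, Λ.χ i ≠ 0 → N i = Λ.χ i * dd) ∧ ∀ a ∈ ch, ∑ k, a k * N k = 0 := by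
  rw [Λ.mem_E_iff]
  have hd : (dd : ℝ) ≠ 0 := by positivity
  have hlin : ∀ a : Fin Q.D → ℤ, lin a (fun k => (N k : ℝ) / dd) = ((∑ k, a k * N k : ℤ) : ℝ) / dd := by
    intro a; simp only [lin]; push_cast; rw [Finset.sum_div]
    exact Finset.sum_congr rfl fun k _ => by ring
  constructor
  · rintro ⟨h1, h2⟩
    refine ⟨fun i hi => ?_, fun a ha => ?_⟩
    · have := h1 i hi
      rw [div_eq_iff hd] at this
      exact_mod_cast this
    · have := h2 a ha
      rw [hlin, div_eq_zero_iff] at this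
      rcases this with h | h
      · exact_mod_cast h
      · exact absurd h hd
  · rintro ⟨h1, h2⟩
    refine ⟨fun i hi => ?_, fun a ha => ?_⟩
    · rw [div_eq_iff hd]; exact_mod_cast h1 i hi
    · rw [hlin, h2 a ha]; simp

/-- `lin a (N/dd) ≠ 0 ↔ a·N ≠ 0`. [folklore] -/
theorem lin_div_ne_zero_iff (a N : Fin D → ℤ) {dd : ℕ} (hdd : 0 < dd) :
    lin a (fun k => (N k : ℝ) / dd) ≠ 0 ↔ ∑ k, a k * N k ≠ 0 := by
  have hd : (dd : ℝ) ≠ 0 := by positivity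
  have hlin : lin a (fun k => (N k : ℝ) / dd) = ((∑ k, a k * N k : ℤ) : ℝ) / dd := by
    simp only [lin]; push_cast; rw [Finset.sum_div]
    exact Finset.sum_congr rfl fun k _ => by ring
  rw [hlin, Ne, div_eq_zero_iff, not_or]
  constructor
  · rintro ⟨h, -⟩; exact_mod_cast h
  · intro h; exact ⟨by exact_mod_cast h, hd⟩

/-- `lin a (N/dd) = 0 ↔ a·N = 0`. [folklore] -/
theorem lin_div_eq_zero_iff (a N : Fin D → ℤ) {dd : ℕ} (hdd : 0 < dd) :
    lin a (fun k => (N k : ℝ) / dd) = 0 ↔ ∑ k, a k * N k = 0 := by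
  have := lin_div_ne_zero_iff a N hdd
  tauto

/-- Any decoded coefficient is below `2^b` (chunks of at most `b+1` bits). [folklore] -/
theorem natAbs_decodeForm_lt' (b D : ℕ) (w : List Bool) (i : Fin D) : (decodeForm b D w i).natAbs < 2 ^ b := by
  rw [decodeForm]
  set c := (w.drop (i.val * (b + 1))).take (b + 1)
  by_cases hc : c = []
  · rw [hc]; simp [chunkInt]
  · refine lt_of_lt_of_le (natAbs_chunkInt_lt c hc) (Nat.pow_le_pow_right (by norm_num) ?_)
    have : c.length ≤ b + 1 := List.length_take_le _ _
    omega

/-- The decoded denominator is below `2^W`. [folklore] -/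
theorem decodeApex_snd_lt (W D : ℕ) (w : List Bool) : (decodeApex W D w).2 < 2 ^ W := by
  simp only [decodeApex]
  refine lt_of_lt_of_le (bitsToNat_lt _) (Nat.pow_le_pow_right (by norm_num) (List.length_take_le _ _))

/-- Untyped decoding of the two points of a certificate. [folklore] -/
theorem uPts_eq (cert : List Bool) :
    uPts Q.toU cert = ((List.ofFn (decodeApex Q.W Q.D ((cert.drop Q.Wf).take Q.Wa)).1, (decodeApex Q.W Q.D ((cert.drop Q.Wf).take Q.Wa)).2),
      (List.ofFn (decodeApex Q.W Q.D ((cert.drop (Q.Wf + Q.Wa)).take Q.Wa)).1, (decodeApex Q.W Q.D ((cert.drop (Q.Wf + Q.Wa)).take Q.Wa)).2)) := by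
  simp only [uPts, ← toU_decodeApex]; rfl

/-- The data fields read by the verifiers. [folklore] -/
theorem toU_fields (dat : Data Q.D) :
    dat.toU.chart = List.ofFn dat.chart ∧ dat.toU.cur.m = List.ofFn dat.cur.m ∧
      dat.toU.cur.chain = dat.cur.chain.map List.ofFn ∧
      dat.toU.levels.map ULevelRec.apexN = (dat.levels.map fun r => r.apex.1).map List.ofFn ∧
      dat.toU.cur.bits = dat.cur.bits := by
  refine ⟨rfl, rfl, rfl, ?_, rfl⟩
  simp [Data.toU, LevelRec.toU, List.map_map, Function.comp_def]

end Bridges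

/-! ### The equivalences -/

section Equiv

variable {Q : LevelParams}

/-- **The triple core decides `ValidTriple` on decoded data.** [cite: FournierKoiran2000, §2.1] -/
theorem uTripleCore_iff (dat : Data Q.D) (sc : ℕ) (a N N' : Fin Q.D → ℤ) (dd dd' : ℕ)
    (hN : ∀ k, (N k).natAbs < 2 ^ Q.W) (hdd : dd < 2 ^ Q.W) (hN' : ∀ k, (N' k).natAbs < 2 ^ Q.W) (hdd' : dd' < 2 ^ Q.W) :
    uTripleCore Q.toU Q.B dat.toU sc (List.ofFn a) (List.ofFn N, dd) (List.ofFn N', dd') = true ↔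
      0 < dd ∧ 0 < dd' ∧ dat.ctx.ValidTriple sc dat.cur.chain a (fun k => (N k : ℝ) / dd) (fun k => (N' k : ℝ) / dd') := by
  obtain ⟨hχ, hm, hch, hprev, -⟩ := toU_fields dat
  have hκ : Q.toU.κ = Q.κ := rfl
  have hmeet := uMeetsI_iff dat.ctx sc a
  simp only [show dat.ctx.χ = dat.chart from rfl, show dat.ctx.m = dat.cur.m from rfl] at hmeet
  simp only [uTripleCore, hχ, hm, hch, hprev, hκ, Bool.and_eq_true, Bool.not_eq_true', decide_eq_false_iff_not,
    decide_eq_true_eq, uLiveI_iff, uInE_iff, hmeet, udot_ofFn]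
  simp only [LevelCtx.ValidTriple, LevelCtx.mem_F, LevelCtx.LiveI, show dat.ctx.prev = dat.levels.map (fun r => r.apex.1) from rfl]
  constructor
  · rintro ⟨⟨⟨⟨⟨hlive, hmeets⟩, hdpos, hfix, hzero⟩, hne⟩, hdpos', hfix', hzero'⟩, heq⟩
    exact ⟨hdpos, hdpos', ⟨hlive, hmeets⟩, ⟨N, dd, hdpos, hdd, hN, rfl⟩, (mem_E_div_iff dat.ctx _ N hdpos).2 ⟨hfix, hzero⟩,
      (lin_div_ne_zero_iff a N hdpos).2 hne, ⟨N', dd', hdpos', hdd', hN', rfl⟩, (mem_E_div_iff dat.ctx _ N' hdpos').2 ⟨hfix', hzero'⟩,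
      (lin_div_eq_zero_iff a N' hdpos').2 heq⟩
  · rintro ⟨hdpos, hdpos', ⟨hlive, hmeets⟩, -, hE, hne, -, hE', heq⟩
    obtain ⟨hfix, hzero⟩ := (mem_E_div_iff dat.ctx _ N hdpos).1 hE
    obtain ⟨hfix', hzero'⟩ := (mem_E_div_iff dat.ctx _ N' hdpos').1 hE'
    exact ⟨⟨⟨⟨⟨hlive, hmeets⟩, hdpos, hfix, hzero⟩, (lin_div_ne_zero_iff a N hdpos).1 hne⟩, hdpos', hfix', hzero'⟩,
      (lin_div_eq_zero_iff a N' hdpos').1 heq⟩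

/-- A valid triple has small-coded members. [folklore] -/
theorem validTriple_cert (dat : Data Q.D) {sc : ℕ} {a : Fin Q.D → ℤ} {z z' : Fin Q.D → ℝ}
    (h : dat.ctx.ValidTriple sc dat.cur.chain a z z') :
    ∃ (N : Fin Q.D → ℤ) (dd : ℕ) (N' : Fin Q.D → ℤ) (dd' : ℕ), 0 < dd ∧ dd < 2 ^ Q.W ∧ (∀ k, (N k).natAbs < 2 ^ Q.W) ∧
      0 < dd' ∧ dd' < 2 ^ Q.W ∧ (∀ k, (N' k).natAbs < 2 ^ Q.W) ∧ (∀ i, (a i).natAbs ≤ Q.B) ∧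
      z = (fun k => (N k : ℝ) / dd) ∧ z' = (fun k => (N' k : ℝ) / dd') := by
  obtain ⟨ha, ⟨N, dd, hdd0, hdd, hN, rfl⟩, -, -, ⟨N', dd', hdd0', hdd', hN', rfl⟩, -, -⟩ := h
  exact ⟨N, dd, N', dd', hdd0, hdd, hN, hdd0', hdd', hN', ((dat.ctx.mem_F).1 ha).1.1, rfl, rfl⟩

/-- The sizes of the typed parameters. [folklore] -/
theorem toU_sizes : Q.toU.bB = Q.bB ∧ Q.toU.D = Q.D ∧ Q.toU.W = Q.W ∧ Q.toU.Wf = Q.Wf ∧ Q.toU.Wa = Q.Wa ∧ Q.toU.L = Q.L ∧ Q.toU.κ = Q.κ :=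
  ⟨rfl, rfl, rfl, rfl, rfl, rfl, rfl⟩

/-- `B < 2^{bB}`. [folklore] -/
theorem B_lt_two_pow_bB : Q.B < 2 ^ Q.bB := Nat.lt_size_self _

/-- Extracting the three blocks of a concatenated certificate. [folklore] -/
theorem blocks_of_append (u v w : List Bool) (hu : u.length = Q.Wf) (hv : v.length = Q.Wa) :
    (u ++ v ++ w).take Q.Wf = u ∧ ((u ++ v ++ w).drop Q.Wf).take Q.Wa = v ∧ ((u ++ v ++ w).drop (Q.Wf + Q.Wa)).take Q.Wa = w.take Q.Wa := by
  refine ⟨?_, ?_, ?_⟩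
  · rw [List.append_assoc, List.take_left' hu]
  · rw [List.append_assoc, List.drop_left' hu, List.take_left' hv]
  · rw [List.append_assoc, ← List.drop_drop, List.drop_left' hu, List.drop_left' hv]

/-- **Completeness of `uExCheck`**: a true existence query has a certificate of length `Wf + 2Wa`.
[cite: FournierKoiran2000, §2.1–2.2] -/
theorem npTruth_ex_complete (dat : Data Q.D) (sc m : ℕ) (finT : Cert Q.D → Prop) (Γof : Data Q.D → Cert Q.D)
    (h : npTruth finT Γof dat (Task.ex sc m)) :
    ∃ cert : List Bool, cert.length = Q.Wf + 2 * Q.Wa ∧ uExCheck Q.toU Q.B dat.toU sc cert = true := by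
  obtain ⟨hbB, hD, hW, hWf, hWa, -, -⟩ := (toU_sizes (Q := Q))
  obtain ⟨a, z, z', h⟩ := h
  obtain ⟨N, dd, N', dd', hdd0, hdd, hN, hdd0', hdd', hN', haB, rfl, rfl⟩ := validTriple_cert dat h
  have haB' : ∀ i, (a i).natAbs < 2 ^ Q.bB := fun i => lt_of_le_of_lt (haB i) B_lt_two_pow_bB
  refine ⟨encodeForm Q.bB a ++ encodeApex Q.W N dd ++ encodeApex Q.W N' dd', ?_, ?_⟩
  · simp only [List.length_append, length_encodeForm, length_encodeApex, LevelParams.Wf, LevelParams.Wa]; ring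
  · have hu : (encodeForm Q.bB a).length = Q.Wf := by rw [length_encodeForm]; rfl
    have hv : (encodeApex Q.W N dd).length = Q.Wa := by rw [length_encodeApex]; rfl
    have hw : (encodeApex Q.W N' dd').length = Q.Wa := by rw [length_encodeApex]; rfl
    obtain ⟨h1, h2, h3⟩ := blocks_of_append (Q := Q) _ _ (encodeApex Q.W N' dd') hu hv
    rw [uExCheck, uPts_eq, hbB, hD, hWf, h1, h2, h3, List.take_of_length_le (le_of_eq hw),
      ← ofFn_decodeForm, decodeForm_encodeForm haB', decodeApex_encodeApex hdd hN, decodeApex_encodeApex hdd' hN']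
    exact (uTripleCore_iff dat sc a N N' dd dd' hN hdd hN' hdd').2 ⟨hdd0, hdd0', h⟩

/-- **Soundness of `uExCheck`**: any accepted certificate proves the existence query. [cite: FournierKoiran2000, §2.1] -/
theorem npTruth_ex_sound (dat : Data Q.D) (sc m : ℕ) (finT : Cert Q.D → Prop) (Γof : Data Q.D → Cert Q.D) (cert : List Bool)
    (h : uExCheck Q.toU Q.B dat.toU sc cert = true) : npTruth finT Γof dat (Task.ex sc m) := by
  obtain ⟨hbB, hD, hW, hWf, hWa, -, -⟩ := (toU_sizes (Q := Q))
  rw [uExCheck, uPts_eq, hbB, hD, hWf, ← ofFn_decodeForm] at h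
  set a := decodeForm Q.bB Q.D (cert.take Q.Wf)
  set p := decodeApex Q.W Q.D ((cert.drop Q.Wf).take Q.Wa)
  set p' := decodeApex Q.W Q.D ((cert.drop (Q.Wf + Q.Wa)).take Q.Wa)
  have hN : ∀ k, (p.1 k).natAbs < 2 ^ Q.W := fun k => natAbs_decodeForm_lt' Q.W Q.D _ k
  have hN' : ∀ k, (p'.1 k).natAbs < 2 ^ Q.W := fun k => natAbs_decodeForm_lt' Q.W Q.D _ k
  have h' := (uTripleCore_iff dat sc a p.1 p'.1 p.2 p'.2 hN (decodeApex_snd_lt _ _ _) hN' (decodeApex_snd_lt _ _ _)).1 h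
  exact ⟨a, _, _, h'.2.2⟩

/-- **Completeness of `uPfCheck`.** [cite: FournierKoiran2000, §2.1–2.2] -/
theorem npTruth_pf_complete (dat : Data Q.D) (sc m w : ℕ) (finT : Cert Q.D → Prop) (Γof : Data Q.D → Cert Q.D)
    (h : npTruth finT Γof dat (Task.pf sc m w)) :
    ∃ cert : List Bool, cert.length = Q.Wf + 2 * Q.Wa ∧ uPfCheck Q.toU Q.B dat.toU sc cert = true := by
  obtain ⟨hbB, hD, hW, hWf, hWa, -, -⟩ := (toU_sizes (Q := Q))
  have hbits : dat.toU.cur.bits = dat.cur.bits := rfl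
  obtain ⟨u, ⟨hlen, z, z', h⟩, -, hpre⟩ := h
  obtain ⟨N, dd, N', dd', hdd0, hdd, hN, hdd0', hdd', hN', haB, rfl, rfl⟩ := validTriple_cert dat h
  refine ⟨u ++ encodeApex Q.W N dd ++ encodeApex Q.W N' dd', ?_, ?_⟩
  · simp only [List.length_append, hlen, length_encodeApex, LevelParams.Wa]; ring
  · have hv : (encodeApex Q.W N dd).length = Q.Wa := by rw [length_encodeApex]; rfl
    have hw : (encodeApex Q.W N' dd').length = Q.Wa := by rw [length_encodeApex]; rfl
    obtain ⟨h1, h2, h3⟩ := blocks_of_append (Q := Q) _ _ (encodeApex Q.W N' dd') hlen hv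
    simp only [uPfCheck, uExCheck, uPts_eq, hbB, hD, hWf, hbits, h1, h2, h3, List.take_of_length_le (le_of_eq hw),
      ← ofFn_decodeForm, decodeApex_encodeApex hdd hN, decodeApex_encodeApex hdd' hN', Bool.and_eq_true, decide_eq_true_eq]
    refine ⟨⟨by simp [hlen], ?_⟩, (uTripleCore_iff dat sc _ N N' dd dd' hN hdd hN' hdd').2 ⟨hdd0, hdd0', h⟩⟩
    obtain ⟨t, rfl⟩ := hpre
    exact List.take_left' (by simp)

/-- **Soundness of `uPfCheck`.** [cite: FournierKoiran2000, §2.1] -/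
theorem npTruth_pf_sound (dat : Data Q.D) (sc m w : ℕ) (finT : Cert Q.D → Prop) (Γof : Data Q.D → Cert Q.D) (cert : List Bool)
    (h : uPfCheck Q.toU Q.B dat.toU sc cert = true) : npTruth finT Γof dat (Task.pf sc m w) := by
  obtain ⟨hbB, hD, hW, hWf, hWa, -, -⟩ := (toU_sizes (Q := Q))
  have hbits : dat.toU.cur.bits = dat.cur.bits := rfl
  simp only [uPfCheck, Bool.and_eq_true, decide_eq_true_eq] at h
  obtain ⟨⟨hlen, hpre⟩, h⟩ := h
  rw [uExCheck, uPts_eq, hbB, hD, hWf, ← ofFn_decodeForm] at h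
  rw [hWf, hbits] at *
  set p := decodeApex Q.W Q.D ((cert.drop Q.Wf).take Q.Wa)
  set p' := decodeApex Q.W Q.D ((cert.drop (Q.Wf + Q.Wa)).take Q.Wa)
  have hN : ∀ k, (p.1 k).natAbs < 2 ^ Q.W := fun k => natAbs_decodeForm_lt' Q.W Q.D _ k
  have hN' : ∀ k, (p'.1 k).natAbs < 2 ^ Q.W := fun k => natAbs_decodeForm_lt' Q.W Q.D _ k
  have h' := (uTripleCore_iff dat sc _ p.1 p'.1 p.2 p'.2 hN (decodeApex_snd_lt _ _ _) hN' (decodeApex_snd_lt _ _ _)).1 h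
  have htake : (cert.take Q.Wf).length = Q.Wf := by rw [List.length_take]; exact min_eq_left hlen
  exact ⟨cert.take Q.Wf, ⟨htake, _, _, h'.2.2⟩, htake, (cert.take Q.Wf).drop (dat.cur.bits.length + 1), by
    rw [← hpre, List.take_append_drop]⟩

/-- The stability core on decoded data. [folklore] -/
theorem uStCore_iff (dat : Data Q.D) (sc : ℕ) (a N : Fin Q.D → ℤ) (dd : ℕ) :
    ((uLiveI Q.B (dat.toU.levels.map ULevelRec.apexN) (List.ofFn a) && uMeetsI Q.toU.κ (sc + 1) dat.toU.chart dat.toU.cur.m (List.ofFn a) &&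
      uInE dat.toU.chart dat.toU.cur.chain (List.ofFn N) dd && !decide (udot (List.ofFn a) (List.ofFn N) = 0)) = true ↔
    0 < dd ∧ a ∈ dat.ctx.F (sc + 1) ∧ (fun k => (N k : ℝ) / dd) ∈ dat.ctx.E dat.cur.chain ∧ lin a (fun k => (N k : ℝ) / dd) ≠ 0) := by
  obtain ⟨hχ, hm, hch, hprev, -⟩ := toU_fields dat
  have hκ : Q.toU.κ = Q.κ := rfl
  have hmeet := uMeetsI_iff dat.ctx (sc + 1) a
  simp only [show dat.ctx.χ = dat.chart from rfl, show dat.ctx.m = dat.cur.m from rfl] at hmeet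
  simp only [hχ, hm, hch, hprev, hκ, Bool.and_eq_true, Bool.not_eq_true', decide_eq_false_iff_not, uLiveI_iff, uInE_iff,
    hmeet, LevelCtx.mem_F, udot_ofFn]
  constructor
  · rintro ⟨⟨⟨hlive, hmeets⟩, hd0, hfix, hzero⟩, hne⟩
    exact ⟨hd0, ⟨hlive, hmeets⟩, (mem_E_div_iff dat.ctx _ N hd0).2 ⟨hfix, hzero⟩, (lin_div_ne_zero_iff a N hd0).2 hne⟩
  · rintro ⟨hd0, ⟨hlive, hmeets⟩, hE, hne⟩
    obtain ⟨hfix, hzero⟩ := (mem_E_div_iff dat.ctx _ N hd0).1 hE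
    exact ⟨⟨⟨hlive, hmeets⟩, hd0, hfix, hzero⟩, (lin_div_ne_zero_iff a N hd0).1 hne⟩

/-- **Completeness of `uStCheck`.** [cite: FournierKoiran2000, §2.1–2.2] -/
theorem npTruth_st_complete (dat : Data Q.D) (sc : ℕ) (finT : Cert Q.D → Prop) (Γof : Data Q.D → Cert Q.D)
    (h : npTruth finT Γof dat (Task.st sc)) :
    ∃ cert : List Bool, cert.length = Q.Wf + 2 * Q.Wa ∧ uStCheck Q.toU Q.B dat.toU sc cert = true := by
  obtain ⟨hbB, hD, hW, hWf, hWa, -, hκ⟩ := (toU_sizes (Q := Q))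
  obtain ⟨a, ha, z, ⟨N, dd, hdd0, hdd, hN, rfl⟩, hE, hne⟩ := h
  have haB : ∀ i, (a i).natAbs < 2 ^ Q.bB := fun i => lt_of_le_of_lt (((dat.ctx.mem_F).1 ha).1.1 i) B_lt_two_pow_bB
  refine ⟨encodeForm Q.bB a ++ encodeApex Q.W N dd ++ List.replicate Q.Wa false, ?_, ?_⟩
  · simp only [List.length_append, length_encodeForm, length_encodeApex, List.length_replicate, LevelParams.Wf, LevelParams.Wa]; ring
  · have hu : (encodeForm Q.bB a).length = Q.Wf := by rw [length_encodeForm]; rfl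
    have hv : (encodeApex Q.W N dd).length = Q.Wa := by rw [length_encodeApex]; rfl
    obtain ⟨h1, h2, -⟩ := blocks_of_append (Q := Q) _ _ (List.replicate Q.Wa false) hu hv
    simp only [uStCheck, uPts_eq, hbB, hD, hWf, h1, h2, ← ofFn_decodeForm, decodeForm_encodeForm haB, decodeApex_encodeApex hdd hN]
    exact (uStCore_iff dat sc a N dd).2 ⟨hdd0, ha, hE, hne⟩

/-- **Soundness of `uStCheck`.** [cite: FournierKoiran2000, §2.1] -/
theorem npTruth_st_sound (dat : Data Q.D) (sc : ℕ) (finT : Cert Q.D → Prop) (Γof : Data Q.D → Cert Q.D) (cert : List Bool)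
    (h : uStCheck Q.toU Q.B dat.toU sc cert = true) : npTruth finT Γof dat (Task.st sc) := by
  obtain ⟨hbB, hD, hW, hWf, hWa, -, hκ⟩ := (toU_sizes (Q := Q))
  simp only [uStCheck, uPts_eq, hbB, hD, hWf, ← ofFn_decodeForm] at h
  set a := decodeForm Q.bB Q.D (cert.take Q.Wf)
  set p := decodeApex Q.W Q.D ((cert.drop Q.Wf).take Q.Wa)
  have hN : ∀ k, (p.1 k).natAbs < 2 ^ Q.W := fun k => natAbs_decodeForm_lt' Q.W Q.D _ k
  obtain ⟨hd0, ha, hE, hne⟩ := (uStCore_iff dat sc a p.1 p.2).1 h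
  exact ⟨a, ha, _, ⟨p.1, p.2, hd0, decodeApex_snd_lt _ _ _, hN, rfl⟩, hE, hne⟩

/-- `uNear` in typed terms. [folklore] -/
theorem uNear_iff {D : ℕ} (L e : ℕ) (χ m N : Fin D → ℤ) (dd : ℕ) :
    uNear L e (List.ofFn χ) (List.ofFn m) (List.ofFn N) dd = true ↔
      ∀ i, χ i = 0 → 4 * (N i * 2 ^ (L + 1) - m i * dd).natAbs ≤ dd * 2 ^ e := by
  have hz : List.zip (List.ofFn m) (List.ofFn N) = List.ofFn fun i => (m i, N i) := zipWith_ofFn _ _ _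
  simp only [uNear, hz, zipWith_ofFn, all_ofFn, id, decide_eq_true_eq]

/-- Membership of `N/dd` in all equations of `Esys ch`, integer form. [folklore] -/
theorem esys_int_iff (Λ : LevelCtx Q) (ch : List (Fin Q.D → ℤ)) (N : Fin Q.D → ℤ) (dd : ℕ) :
    (∀ e ∈ Λ.Esys ch, ∑ k, e.1 k * N k = e.2 * dd) ↔ (∀ i, Λ.χ i ≠ 0 → N i = Λ.χ i * dd) ∧ ∀ a ∈ ch, ∑ k, a k * N k = 0 := by
  simp only [LevelCtx.Esys, List.mem_append, List.mem_map]
  constructor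
  · intro h
    refine ⟨fun i hi => ?_, fun a ha => ?_⟩
    · have := h _ (Or.inl (Λ.mem_chartEqns.2 ⟨i, hi, rfl⟩))
      simpa [Pi.single_apply, Finset.sum_ite_eq'] using this
    · have := h (a, 0) (Or.inr ⟨a, ha, rfl⟩)
      simpa using this
  · rintro ⟨h1, h2⟩ e he
    rcases he with he | ⟨a, ha, rfl⟩
    · obtain ⟨i, hi, rfl⟩ := Λ.mem_chartEqns.1 he
      simpa [Pi.single_apply, Finset.sum_ite_eq'] using h1 i hi
    · simpa using h2 a ha

/-- The apex core on decoded data. [folklore] -/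
theorem uApCore_iff (dat : Data Q.D) (u : List Bool) :
    let pr := dat.cur.stable.getD (0, [])
    (uInE dat.toU.chart (pr.2.map List.ofFn) (List.ofFn (decodeApex Q.W Q.D u).1) (decodeApex Q.W Q.D u).2 = true ∧
      uNear Q.L (Q.κ * (pr.1 + 1)) dat.toU.chart dat.toU.cur.m (List.ofFn (decodeApex Q.W Q.D u).1) (decodeApex Q.W Q.D u).2 = true) ↔
      dat.ctx.ApexPredCh pr.1 pr.2 (decodeApex Q.W Q.D u).1 (decodeApex Q.W Q.D u).2 := by
  intro pr
  obtain ⟨hχ, hm, -, -, -⟩ := toU_fields dat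
  simp only [hχ, hm, uInE_iff, uNear_iff, LevelCtx.ApexPredCh, esys_int_iff]
  have hN : ∀ k, ((decodeApex Q.W Q.D u).1 k).natAbs < 2 ^ Q.W := fun k => natAbs_decodeForm_lt' Q.W Q.D _ k
  have hdd := decodeApex_snd_lt Q.W Q.D u
  constructor
  · rintro ⟨⟨h0, h1, h2⟩, h3⟩; exact ⟨h0, hdd, hN, ⟨h1, h2⟩, h3⟩
  · rintro ⟨h0, -, -, ⟨h1, h2⟩, h3⟩; exact ⟨⟨h0, h1, h2⟩, h3⟩

/-- The stable-pair fields of the untyped scratch. [folklore] -/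
theorem toU_stable_fields (dat : Data Q.D) {U : ℕ} (hU : (dat.cur.stable.getD (0, [])).1 ≤ U) :
    min ((dat.toU.cur.stable.map Prod.fst).getD 0) U = (dat.cur.stable.getD (0, [])).1 ∧
      (dat.toU.cur.stable.map Prod.snd).getD [] = (dat.cur.stable.getD (0, [])).2.map List.ofFn := by
  have h1 : (dat.toU.cur.stable.map Prod.fst).getD 0 = (dat.cur.stable.getD (0, [])).1 := by
    simp only [Data.toU, Scratch.toU, Option.map_map]; rcases dat.cur.stable with _ | p <;> rfl
  have h2 : (dat.toU.cur.stable.map Prod.snd).getD [] = (dat.cur.stable.getD (0, [])).2.map List.ofFn := by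
    simp only [Data.toU, Scratch.toU, Option.map_map]; rcases dat.cur.stable with _ | p <;> rfl
  exact ⟨by rw [h1]; exact min_eq_left hU, h2⟩

/-- **Completeness of `uApCheck`.** [cite: FournierKoiran2000, §2.1–2.2] -/
theorem npTruth_ap_complete (dat : Data Q.D) (w : ℕ) (finT : Cert Q.D → Prop) (Γof : Data Q.D → Cert Q.D) {U : ℕ}
    (hU : (dat.cur.stable.getD (0, [])).1 ≤ U) (h : npTruth finT Γof dat (Task.ap w)) :
    ∃ cert : List Bool, cert.length = Q.Wa ∧ uApCheck Q.toU U dat.toU cert = true := by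
  obtain ⟨hbB, hD, hW, hWf, hWa, hL, hκ⟩ := (toU_sizes (Q := Q))
  obtain ⟨hsc, hchn⟩ := toU_stable_fields dat hU
  have hbits : dat.toU.cur.bits = dat.cur.bits := rfl
  obtain ⟨u, ⟨hlen, hP⟩, -, hpre⟩ := h
  refine ⟨u, hlen, ?_⟩
  simp only [uApCheck, hsc, hchn, hW, hD, hWa, hL, hκ, hbits, ← toU_decodeApex, List.take_of_length_le (le_of_eq hlen),
    Bool.and_eq_true, decide_eq_true_eq]
  refine ⟨⟨⟨le_of_eq hlen.symm, ?_⟩, ((uApCore_iff dat u).2 hP).1⟩, ((uApCore_iff dat u).2 hP).2⟩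
  obtain ⟨t, rfl⟩ := hpre
  exact List.take_left' (by simp)

/-- **Soundness of `uApCheck`.** [cite: FournierKoiran2000, §2.1] -/
theorem npTruth_ap_sound (dat : Data Q.D) (w : ℕ) (finT : Cert Q.D → Prop) (Γof : Data Q.D → Cert Q.D) {U : ℕ}
    (hU : (dat.cur.stable.getD (0, [])).1 ≤ U) (cert : List Bool) (h : uApCheck Q.toU U dat.toU cert = true) :
    npTruth finT Γof dat (Task.ap w) := by
  obtain ⟨hbB, hD, hW, hWf, hWa, hL, hκ⟩ := (toU_sizes (Q := Q))
  obtain ⟨hsc, hchn⟩ := toU_stable_fields dat hU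
  have hbits : dat.toU.cur.bits = dat.cur.bits := rfl
  simp only [uApCheck, hsc, hchn, hW, hD, hWa, hL, hκ, hbits, ← toU_decodeApex, Bool.and_eq_true, decide_eq_true_eq] at h
  obtain ⟨⟨⟨hlen, hpre⟩, hin⟩, hnear⟩ := h
  have htake : (cert.take Q.Wa).length = Q.Wa := by rw [List.length_take]; exact min_eq_left hlen
  exact ⟨cert.take Q.Wa, ⟨htake, (uApCore_iff dat (cert.take Q.Wa)).1 ⟨hin, hnear⟩⟩, htake, (cert.take Q.Wa).drop (dat.cur.bits.length + 1), by
    rw [← hpre, List.take_append_drop]⟩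

end Equiv

end FKPointLocation

end Literature.Computability.Complexity
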